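import Summits.BirchSwinnertonDyer.BirchSwinnertonDyer.Theorems.KatoDescentPotSupersingularWildJetchevBoundAtPGross1991
import Summits.BirchSwinnertonDyer.BirchSwinnertonDyer.Theorems.KatoDescentTamePotSupersingularJetchevIrreducibleProp47OfGross37
import HarnessLib

/-!
# Route `KatoDescentPotSupersingular` (rung K9, cell `bsd-potss`): crux `WildJetchevBoundAtP` (19941) — the `H63Ip` node FROM THREE NAMED
# LITERATURE FACTS ONLY {Gross 3.7 (2), Poitou–Tate, [GZ86 III (3.1)] image-free}, and k9-c4 g9's `h44I`-keyed END FORM with `hGZ` fed by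
# name — sequel (part 2, split for the 400-line rule) of `…WildJetchevBoundAtPGross1991`; seat `bsd-potss-k9-c4` g10; route-free;
# `--supports 19941`, helper

HONEST FRAMING. Theorems only; CONDITIONAL on every displayed hypothesis; nothing booked, no item closed, 19941 / 20165 / their stubs
and BSD stay open. WHAT THIS IS (see part 1 for the context):
* `thm63AtP_of_poitouTate_of_Gross1991 (h44I) (hPT) (hF1)` — k9-c4 g9's `WildJetchevBoundAtPNamedPrintOnly.thm63AtP_of_poitouTate_of_GZ31`
  (p541256, keyed on the REGISTERED S5 text `h44I` = `Sig.stub_prop44Irred`) with the closed receptacle schema `hGZ` replaced by the named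
  Literature fact `Gross1991_heegnerPoint_sub_ratTorsion_mem_E0_imageFree` (via part 1's `h47P2_of_h44I` and
  `thm63AtP_of_poitouTate_of_Gross1991_of_prop47P2`);
* `thm63AtP_of_prop37_2_of_poitouTate_of_Gross1991 (h37) (hPT) (hF1)` — with k8t-c4 g11's `JetchevIrreducibleProp44.h47P2_of_prop37_2`
  (p541604): **the `H63Ip` node of 19941 from THREE NAMED LITERATURE FACTS ONLY** — `GrossLMS1991.prop37_2_frobeniusCongruence`
  (Gross 1991 Prop. 3.7 (2), typed image-free after Nekovář 2007 Prop. 4.13 (ii)), `poitouTate_selmerStructure_duality_conj`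
  (Poitou–Tate for the tree's Selmer structures, ∀ K; bsd-jet ARM P), `Gross1991_heegnerPoint_sub_ratTorsion_mem_E0_imageFree`
  ([GZ86 III (3.1)] / Gross p. 245, image-free) — no closed schema, no completion-layer gap, no reading displayed at this node.
ACCOUNTING (crux 19941): 19941 ⟸ S1 (`stub_structureIrred`, MN19 Thm. 0.7, held by name) ∧ S2′ (`stub_prop52IrredP`) ∧
S3′ (`stub_coreVertexExistenceIrredP`) ∧ {Gross 3.7 (2), Poitou–Tate, GZ86 III (3.1): NAMED Literature facts} ∧ `PublishedInputsHeegner` ∧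
[d_K = −4 supplement] (via p518161 §3 ∘ p522249 ∘ this file). BSD is not proved by any of this.

References: [cite: Jetchev2008, Thm. 1.4, Thm. 5.2 (p. 821), Prop. 4.7, Thm. 6.3] [cite: McCallumLMS1991, §4 Prop. 4.4]
[cite: GrossLMS1991, §1 p. 235, Prop. 3.7 (2), §6 proof of Prop. 6.2 (1) p. 245] [cite: GrossZagier1986Heegner, III (3.1) Proposition, p. 256]
[cite: Nekovar2007, Prop. 4.13 (ii)] [cite: MilneADT2006, Ch. I, Thm. 4.10(b)].
-/


set_option autoImplicit false
-- the Theorems directory repeats the summit name (sibling precedent `KatoDescentPotSupersingularAssembly.lean`)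
set_option linter.dupNamespace false

noncomputable section

open scoped Classical Pointwise

open WeierstrassCurve IsDedekindDomain NumberField Field Literature.NumberTheory.EllipticCurves
  Literature.NumberTheory.EllipticCurves.ModularForms Literature.NumberTheory.EllipticCurves.Jetchev2008
  Literature.NumberTheory.EllipticCurves.Rank1Residual
  Literature.NumberTheory.GaloisRepresentations Literature.NumberTheory.GaloisCohomology
  Literature.NumberTheory.GaloisRepresentations.DiscreteGaloisModule
  Summit.BirchSwinnertonDyer.Rank1Residual.X11b Summit.BirchSwinnertonDyer.Rank1Residual.X11b.Three
  Summit.BirchSwinnertonDyer.Rank1Residual.JET Summit.BirchSwinnertonDyer.Rank1Residual.JET.SelmerVocabulary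
  Literature.NumberTheory.Automorphic
  Summit.BirchSwinnertonDyer.BirchSwinnertonDyer.Theorems

namespace Summit.BirchSwinnertonDyer.BirchSwinnertonDyer.Theorems.WildJetchevBoundAtPGross1991

/-- **k9-c4 g9's END FORM with `hGZ` fed by name: `H63Ip` ⟸ {`h44I`, `hPT`} + `Gross1991_heegnerPoint_sub_ratTorsion_mem_E0_imageFree`**
(p541256's `thm63AtP_of_poitouTate_of_GZ31` with the closed receptacle schema replaced by the named fact; via `h47P2_of_h44I`).
CONDITIONAL; nothing asserted. [cite: McCallumLMS1991, §4 Prop. 4.4] [cite: GrossLMS1991, §6 p. 245] [cite: GrossZagier1986Heegner, III (3.1)] -/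
theorem thm63AtP_of_poitouTate_of_Gross1991
    (h44I : ∀ (W : WeierstrassCurve ℚ) [W.IsElliptic] [W.IsGloballyMinimal] [NeZero (W.conductorNorm ℤ)],
        ¬ W.HasCM →
        ∀ (K : Type) [Field K] [NumberField K], IsImaginaryQuadratic K →
        NumberField.discr K ≠ -3 → NumberField.discr K ≠ -4 →
        SatisfiesHeegnerHypothesis (W.conductorNorm ℤ) K →
        ∀ (p : ℕ) [Fact p.Prime], p ≠ 2 → W.HasIrreducibleModPGaloisRep p →
        ∀ (Dt : ModularParametrizationData W (W.conductorNorm ℤ)) (β : ℤ) (ι : K →+* ℂ)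
          (M : ℕ), 1 ≤ M →
        ∀ (m l : ℕ), Squarefree (m * l) → l.Prime → ¬ l ∣ m →
          (∀ l' ∈ (m * l).primeFactors, Zhang2014.IsKolyvaginPrime (W.conductorNorm ℤ) W K p l' ∧
            M ≤ Zhang2014.kolyvaginIndex W p l') →
        ∀ (d : KolyvaginHeegnerData Dt β ι m) (d' : KolyvaginHeegnerData Dt β ι (m * l)),
          (∀ l' ∈ m.primeFactors, ∀ (x : ringClassField K ι m) (x' : ringClassField K ι (m * l)),
            (x : ℂ) = x' → ((d'.σ l' x' : ringClassField K ι (m * l)) : ℂ) = (d.σ l' x : ℂ)) →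
          (∀ s ∈ d.S, ∃ s' ∈ d'.S, ∀ (x : ringClassField K ι m) (x' : ringClassField K ι (m * l)),
            (x : ℂ) = x' → ((s' x' : ringClassField K ι (m * l)) : ℂ) = (s x : ℂ)) →
          (∀ s' ∈ d'.S, ∃ s ∈ d.S, ∀ (x : ringClassField K ι m) (x' : ringClassField K ι (m * l)),
            (x : ℂ) = x' → ((s' x' : ringClassField K ι (m * l)) : ℂ) = (s x : ℂ)) →
          (∀ (x : ringClassField K ι m) (x' : ringClassField K ι (m * l)),
            (x : ℂ) = x' → d'.emb x' = d.emb x) →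
        ∀ (v : HeightOneSpectrum (𝓞 K)), (l : 𝓞 K) ∈ v.asIdeal →
        ∀ (j : ℕ),
          (((p ^ j : ℕ) : ℤ) • d'.kolyvaginClass (Fact.out : p.Prime) M ∈
              selmerLocalKer (W.baseChange K) (v.adicCompletion K) ((p ^ M : ℕ) : ℤ) ↔
            ((p ^ j : ℕ) : ℤ) • d'.kolyvaginClass (Fact.out : p.Prime) M ∈
              (W.baseChange K).torsionLocalKer (v.adicCompletion K) ((p ^ M : ℕ) : ℤ)) ∧
          (((p ^ j : ℕ) : ℤ) • d'.kolyvaginClass (Fact.out : p.Prime) M ∈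
              (W.baseChange K).torsionLocalKer (v.adicCompletion K) ((p ^ M : ℕ) : ℤ) ↔
            ((p ^ j : ℕ) : ℤ) • d.kolyvaginClass (Fact.out : p.Prime) M ∈
              (W.baseChange K).torsionLocalKer (v.adicCompletion K) ((p ^ M : ℕ) : ℤ)))
    (hPT : ∀ (K : Type) [Field K] [NumberField K], poitouTate_selmerStructure_duality_conj K)
    (hF1 : Gross1991_heegnerPoint_sub_ratTorsion_mem_E0_imageFree) :
    ∀ (W : WeierstrassCurve ℚ) [W.IsElliptic] [W.IsGloballyMinimal] [NeZero (W.conductorNorm ℤ)],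
      ¬ W.HasCM → ∀ (K : Type) [Field K] [NumberField K], IsImaginaryQuadratic K →
      NumberField.discr K ≠ -3 → NumberField.discr K ≠ -4 →
      SatisfiesHeegnerHypothesis (W.conductorNorm ℤ) K →
      ∀ (τ : K ≃ₐ[ℚ] K), τ ≠ 1 →
      ∀ (p : ℕ) [Fact p.Prime], p ≠ 2 → W.analyticRank = 0 → Addv W p → 0 ≤ padicValRat p W.j →
      W.HasIrreducibleModPGaloisRep p → ¬ (∀ n : ℕ, W.HasSurjectiveModNGaloisRep (p ^ n : ℕ)) →
      (∃ Dt : ModularParametrizationData W (W.conductorNorm ℤ),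
        (∀ z ∈ Dt.L.lattice, ∃ w ∈ periodLattice Dt.f, z = (Dt.c : ℂ) * w) ∧ ¬ (p : ℤ) ∣ Dt.c) →
      ∀ (Dt : ModularParametrizationData W (W.conductorNorm ℤ)) (β : ℤ) (ι : K →+* ℂ)
        [∀ k : ℕ, NumberField (ringClassField K ι k)]
        (d₁ : KolyvaginHeegnerData Dt β ι 1), ¬ IsOfFinAddOrder d₁.derivedPoint →
      ∀ (mdiv m : {c : ℕ // Squarefree c ∧ ∀ ℓ ∈ c.primeFactors,
          Zhang2014.IsKolyvaginPrime (W.conductorNorm ℤ) W K p ℓ} → ℕ∞),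
      (∀ c (u : ℕ), (u : ℕ∞) ≤ mdiv c ↔ ∀ d : KolyvaginHeegnerData Dt β ι c.1,
        ∃ Q : (W.baseChange (ringClassField K ι c.1)).toAffine.Point,
          ((p ^ u : ℕ) : ℤ) • Q = d.derivedPoint) →
      (∀ c, m c = if mdiv c < Zhang2014.levelIndex W p c.1 then mdiv c else ⊤) →
      ∀ mInf : ℕ, (∀ c, (mInf : ℕ∞) ≤ m c) →
        (∀ m' : ℕ, ∃ c, (m' : ℕ∞) ≤ Zhang2014.levelIndex W p c.1 ∧ m c = mInf) →
      ∀ (k : ℕ) c, 1 ≤ k → Jetchev2008.IsGlobalCoreVertex W K ι τ p k c.1 → m c = mInf →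
        (k : ℕ∞) + mInf ≤ Zhang2014.levelIndex W p c.1 →
        padicValNat p ((W.baseChange ℚ_[p]).localTamagawaNumber ℤ_[p]) < k → mInf < k →
        padicValNat p ((W.baseChange ℚ_[p]).localTamagawaNumber ℤ_[p]) ≤ mInf :=
  thm63AtP_of_poitouTate_of_Gross1991_of_prop47P2 (h47P2_of_h44I h44I) hPT hF1

/-- **The `H63Ip` node of crux 19941 from THREE NAMED LITERATURE FACTS ONLY**: Gross 1991 Prop. 3.7 (2)
(`GrossLMS1991.prop37_2_frobeniusCongruence`, feeding `h47P2` by k8t-c4 g11's `JetchevIrreducibleProp44.h47P2_of_prop37_2`, p541604),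
Poitou–Tate duality for the tree's Selmer structures (`poitouTate_selmerStructure_duality_conj`, ∀ K), and [GZ86 III (3.1)] / Gross
p. 245 image-free (`Gross1991_heegnerPoint_sub_ratTorsion_mem_E0_imageFree`). No closed schema, no completion-layer gap and no reading is
displayed at this node any more. CONDITIONAL on the three facts; nothing asserted; BSD is not proved by any of this.
[cite: GrossLMS1991, Prop. 3.7 (2); §6, proof of Prop. 6.2 (1), p. 245] [cite: Nekovar2007, Prop. 4.13 (ii)]
[cite: GrossZagier1986Heegner, III (3.1) Proposition, p. 256] [cite: MilneADT2006, Ch. I, Thm. 4.10(b)] [cite: Jetchev2008, Thm. 5.2, Thm. 6.3] -/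
theorem thm63AtP_of_prop37_2_of_poitouTate_of_Gross1991
    (h37 : GrossLMS1991.prop37_2_frobeniusCongruence)
    (hPT : ∀ (K : Type) [Field K] [NumberField K], poitouTate_selmerStructure_duality_conj K)
    (hF1 : Gross1991_heegnerPoint_sub_ratTorsion_mem_E0_imageFree) :
    ∀ (W : WeierstrassCurve ℚ) [W.IsElliptic] [W.IsGloballyMinimal] [NeZero (W.conductorNorm ℤ)],
      ¬ W.HasCM → ∀ (K : Type) [Field K] [NumberField K], IsImaginaryQuadratic K →
      NumberField.discr K ≠ -3 → NumberField.discr K ≠ -4 →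
      SatisfiesHeegnerHypothesis (W.conductorNorm ℤ) K →
      ∀ (τ : K ≃ₐ[ℚ] K), τ ≠ 1 →
      ∀ (p : ℕ) [Fact p.Prime], p ≠ 2 → W.analyticRank = 0 → Addv W p → 0 ≤ padicValRat p W.j →
      W.HasIrreducibleModPGaloisRep p → ¬ (∀ n : ℕ, W.HasSurjectiveModNGaloisRep (p ^ n : ℕ)) →
      (∃ Dt : ModularParametrizationData W (W.conductorNorm ℤ),
        (∀ z ∈ Dt.L.lattice, ∃ w ∈ periodLattice Dt.f, z = (Dt.c : ℂ) * w) ∧ ¬ (p : ℤ) ∣ Dt.c) →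
      ∀ (Dt : ModularParametrizationData W (W.conductorNorm ℤ)) (β : ℤ) (ι : K →+* ℂ)
        [∀ k : ℕ, NumberField (ringClassField K ι k)]
        (d₁ : KolyvaginHeegnerData Dt β ι 1), ¬ IsOfFinAddOrder d₁.derivedPoint →
      ∀ (mdiv m : {c : ℕ // Squarefree c ∧ ∀ ℓ ∈ c.primeFactors,
          Zhang2014.IsKolyvaginPrime (W.conductorNorm ℤ) W K p ℓ} → ℕ∞),
      (∀ c (u : ℕ), (u : ℕ∞) ≤ mdiv c ↔ ∀ d : KolyvaginHeegnerData Dt β ι c.1,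
        ∃ Q : (W.baseChange (ringClassField K ι c.1)).toAffine.Point,
          ((p ^ u : ℕ) : ℤ) • Q = d.derivedPoint) →
      (∀ c, m c = if mdiv c < Zhang2014.levelIndex W p c.1 then mdiv c else ⊤) →
      ∀ mInf : ℕ, (∀ c, (mInf : ℕ∞) ≤ m c) →
        (∀ m' : ℕ, ∃ c, (m' : ℕ∞) ≤ Zhang2014.levelIndex W p c.1 ∧ m c = mInf) →
      ∀ (k : ℕ) c, 1 ≤ k → Jetchev2008.IsGlobalCoreVertex W K ι τ p k c.1 → m c = mInf →
        (k : ℕ∞) + mInf ≤ Zhang2014.levelIndex W p c.1 →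
        padicValNat p ((W.baseChange ℚ_[p]).localTamagawaNumber ℤ_[p]) < k → mInf < k →
        padicValNat p ((W.baseChange ℚ_[p]).localTamagawaNumber ℤ_[p]) ≤ mInf :=
  thm63AtP_of_poitouTate_of_Gross1991_of_prop47P2 (JetchevIrreducibleProp44.h47P2_of_prop37_2 h37) hPT hF1

end Summit.BirchSwinnertonDyer.BirchSwinnertonDyer.Theorems.WildJetchevBoundAtPGross1991

end
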